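import Summits.QuantumFields.QCD.Theses.SpectralDefectExtinction

/-!
# Stub `stub_diamagnetic` of line `positivity-no-leak-spread`
(crux `Summit.QuantumFields.QCD.Theses.SpectralDefectExtinction.TipNoBinding`, item stmt-QuantumFields-8965)

**Kato's diamagnetic inequality, sitewise** for an `SU(3)` link field `U` on the four-torus `(ℤ/L)⁴`
and a colour ⊗ spin field `ψ`: with the site modulus `|ψ|(x) = √(Σ_{a,α} |ψ(x)_{aα}|²)`,

  `(|ψ|(x+μ̂) − |ψ|(x))² ≤ Σ_{a,α} |Σ_b U(x,μ)_{ab} ψ(x+μ̂)_{bα} − ψ(x)_{aα}|²`.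

Proof.  Put `u_{aα} = Σ_b U(x,μ)_{ab} ψ(x+μ̂)_{bα}` and `v_{aα} = ψ(x)_{aα}`.  Since `U(x,μ)` is unitary
(`U(x,μ)ᴴ U(x,μ) = 1`), `Σ_{a,α} |u_{aα}|² = Σ_{b,α} |ψ(x+μ̂)_{bα}|² = |ψ|(x+μ̂)²` (colour rotation at fixed
spin index is an isometry of `ℂ³`).  The claim is then the squared reverse triangle inequality
`(‖u‖ − ‖v‖)² ≤ ‖u − v‖²` in `ℓ²(Fin 3 × Fin 4, ℂ)`, proved here from the pointwise bound
`(|u_i| − |v_i|)² ≤ |u_i − v_i|²` and the discrete Cauchy–Schwarz inequality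
`Σ |u_i| |v_i| ≤ √(Σ|u_i|²) √(Σ|v_i|²)` (`Real.sum_mul_le_sqrt_mul_sqrt`).
No named facts are used (Mathlib only).
-/

namespace Summit.QuantumFields.QCD.Cruxes.TipNoBinding.PositivityNoLeakSpread

open Literature.MathematicalPhysics Literature.MathematicalPhysics.QuantumLattice
  Literature.MathematicalPhysics.QuantumFieldTheory Literature.Probability.LatticeModels
open Matrix

/-- `Re⟨v, v⟩ = Σ_i ‖v i‖²` for a complex vector `v`. -/
private theorem diamagnetic_re_star_dotProduct_self {n : Type*} [Fintype n] (v : n → ℂ) :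
    (star v ⬝ᵥ v).re = ∑ i, ‖v i‖ ^ 2 := by
  rw [dotProduct, Complex.re_sum]
  refine Finset.sum_congr rfl fun i _ => ?_
  rw [Pi.star_apply, Complex.star_def, ← Complex.normSq_eq_conj_mul_self, Complex.ofReal_re,
    Complex.normSq_eq_norm_sq]

/-- An isometry `A` (`Aᴴ A = 1`) preserves `Σ_i ‖v i‖²`: `Σ_i ‖(A v) i‖² = Σ_i ‖v i‖²`. -/
private theorem diamagnetic_sum_norm_sq_mulVec {n : Type*} [Fintype n] [DecidableEq n]
    (A : Matrix n n ℂ) (hA : Aᴴ * A = 1) (v : n → ℂ) :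
    ∑ i, ‖(A *ᵥ v) i‖ ^ 2 = ∑ i, ‖v i‖ ^ 2 := by
  rw [← diamagnetic_re_star_dotProduct_self, ← diamagnetic_re_star_dotProduct_self, star_mulVec,
    ← dotProduct_mulVec, mulVec_mulVec, hA, one_mulVec]

/-- Squared reverse triangle inequality in `ℓ²(ι, ℂ)`:
`(√(Σ‖f i‖²) − √(Σ‖g i‖²))² ≤ Σ ‖f i − g i‖²`. -/
private theorem diamagnetic_sqrt_sub_sqrt_sq_le {ι : Type*} [Fintype ι] (f g : ι → ℂ) :
    (Real.sqrt (∑ i, ‖f i‖ ^ 2) - Real.sqrt (∑ i, ‖g i‖ ^ 2)) ^ 2 ≤ ∑ i, ‖f i - g i‖ ^ 2 := by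
  have hA : 0 ≤ ∑ i, ‖f i‖ ^ 2 := Finset.sum_nonneg fun _ _ => by positivity
  have hB : 0 ≤ ∑ i, ‖g i‖ ^ 2 := Finset.sum_nonneg fun _ _ => by positivity
  have hCS : ∑ i, ‖f i‖ * ‖g i‖ ≤ Real.sqrt (∑ i, ‖f i‖ ^ 2) * Real.sqrt (∑ i, ‖g i‖ ^ 2) :=
    Real.sum_mul_le_sqrt_mul_sqrt _ _ _
  have hpt : ∀ i, ‖f i‖ ^ 2 + ‖g i‖ ^ 2 - 2 * (‖f i‖ * ‖g i‖) ≤ ‖f i - g i‖ ^ 2 := by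
    intro i
    have h2 : (‖f i‖ - ‖g i‖) ^ 2 ≤ ‖f i - g i‖ ^ 2 := by
      rw [← sq_abs (‖f i‖ - ‖g i‖)]
      exact pow_le_pow_left₀ (abs_nonneg _) (abs_norm_sub_norm_le (f i) (g i)) 2
    calc ‖f i‖ ^ 2 + ‖g i‖ ^ 2 - 2 * (‖f i‖ * ‖g i‖) = (‖f i‖ - ‖g i‖) ^ 2 := by ring
      _ ≤ ‖f i - g i‖ ^ 2 := h2
  have hsum : ∑ i, ‖f i‖ ^ 2 + ∑ i, ‖g i‖ ^ 2 - 2 * ∑ i, ‖f i‖ * ‖g i‖ ≤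
      ∑ i, ‖f i - g i‖ ^ 2 := by
    have h := Finset.sum_le_sum fun i (_ : i ∈ Finset.univ) => hpt i
    rw [Finset.sum_sub_distrib, Finset.sum_add_distrib, ← Finset.mul_sum] at h
    exact h
  rw [sub_sq, Real.sq_sqrt hA, Real.sq_sqrt hB]
  linarith only [hCS, hsum]

/-- **Kato's diamagnetic inequality, sitewise** (registered stub `stub_diamagnetic` of line
`positivity-no-leak-spread`): for every `L ≥ 1`, every `SU(3)` link field `U` on `(ℤ/L)⁴`, every
colour ⊗ spin field `ψ`, every site `x` and direction `μ`,
`(|ψ|(x+μ̂) − |ψ|(x))² ≤ Σ_{a,α} |Σ_b U(x,μ)_{ab} ψ(x+μ̂)_{bα} − ψ(x)_{aα}|²`, where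
`|ψ|(x)² = Σ_{a,α} |ψ(x)_{aα}|²`: `U(x,μ) ⊗ 1_spin` is unitary on the colour ⊗ spin block, so
`‖(U(x,μ) ⊗ 1) ψ(x+μ̂)‖ = |ψ|(x+μ̂)`, and `|‖u‖ − ‖v‖| ≤ ‖u − v‖` in `ℂ^{3×4}`. -/
theorem stub_diamagnetic :
    ∀ (L : ℕ) [NeZero L] (U : GaugeConfig 4 L ↥(Matrix.specialUnitaryGroup (Fin 3) ℂ))
      (ψ : TorusSite 4 L × Fin 3 × Fin 4 → ℂ) (x : TorusSite 4 L) (μ : Fin 4),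
      (Real.sqrt (∑ a, ∑ α, ‖ψ (QuantumFieldTheory.Site.shift x μ, a, α)‖ ^ 2) -
          Real.sqrt (∑ a, ∑ α, ‖ψ (x, a, α)‖ ^ 2)) ^ 2 ≤
        ∑ a, ∑ α, ‖(∑ b, (U (x, μ) : Matrix (Fin 3) (Fin 3) ℂ) a b *
            ψ (QuantumFieldTheory.Site.shift x μ, b, α)) - ψ (x, a, α)‖ ^ 2 := by
  intro L _ U ψ x μ
  -- the link matrix is unitary
  have hM : (U (x, μ) : Matrix (Fin 3) (Fin 3) ℂ)ᴴ * (U (x, μ) : Matrix (Fin 3) (Fin 3) ℂ) = 1 :=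
    Matrix.mem_unitaryGroup_iff'.mp (Matrix.mem_specialUnitaryGroup_iff.mp (U (x, μ)).2).1
  -- the two colour ⊗ spin blocks at `x + μ̂` (rotated by the link) and at `x`, flattened
  set f : Fin 3 × Fin 4 → ℂ := fun p =>
    ∑ b, (U (x, μ) : Matrix (Fin 3) (Fin 3) ℂ) p.1 b * ψ (QuantumFieldTheory.Site.shift x μ, b, p.2)
    with hf
  set g : Fin 3 × Fin 4 → ℂ := fun p => ψ (x, p.1, p.2) with hg
  -- unitarity: `Σ_{a,α} |u_{aα}|² = |ψ|(x+μ̂)²`, spin index by spin index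
  have hu : ∑ p, ‖f p‖ ^ 2 = ∑ a, ∑ α, ‖ψ (QuantumFieldTheory.Site.shift x μ, a, α)‖ ^ 2 := by
    rw [Fintype.sum_prod_type, Finset.sum_comm]
    conv_rhs => rw [Finset.sum_comm]
    refine Finset.sum_congr rfl fun α _ => ?_
    have h := diamagnetic_sum_norm_sq_mulVec _ hM
      (fun b => ψ (QuantumFieldTheory.Site.shift x μ, b, α))
    simpa only [mulVec, dotProduct, hf] using h
  have hv : ∑ p, ‖g p‖ ^ 2 = ∑ a, ∑ α, ‖ψ (x, a, α)‖ ^ 2 := by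
    rw [Fintype.sum_prod_type]
  have hw : ∑ p, ‖f p - g p‖ ^ 2 = ∑ a, ∑ α, ‖(∑ b, (U (x, μ) : Matrix (Fin 3) (Fin 3) ℂ) a b *
      ψ (QuantumFieldTheory.Site.shift x μ, b, α)) - ψ (x, a, α)‖ ^ 2 := by
    rw [Fintype.sum_prod_type]
  rw [← hu, ← hv, ← hw]
  exact diamagnetic_sqrt_sub_sqrt_sq_le f g

end Summit.QuantumFields.QCD.Cruxes.TipNoBinding.PositivityNoLeakSpread
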